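import Summits.Ventures.HSemireg.WedgeSurfacePowersPerQSupport
import Summits.Ventures.HSemireg.FormulaNSurfacePowerPerQ

/-!
# Venture HSemireg — the PER-`q` ranks of the `n`-fold SURFACE BOX, 3/3: THE RANK THEOREM
# `rank(q-block of θ ↦ θ ∧ F_n ∣ ⋀^k K^{4n}) = spCount n k q` for EVERY `n`, `k`, `q` (the ≥ 3-factor statement behind p10's
# corrected enumerator — FORMULA-N PART A §4.1″'s overcount caveat settled as a kernel rank theorem)

HONEST FRAMING. Part of the Lean index of the computation cell `pub-hsemireg` (seat p10 gen 3, Sunday typer «UNIFORM-IN-n»).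
Finite-dimensional EXTERIOR ALGEBRA over a field and integer polynomial arithmetic ONLY: no variety, no cohomology theory, no sheaf,
no Ext group, no semiregularity map is constructed here; nothing here says that HC / HC_CM / HC_AV holds; no Literature fact is
declared or used.  Custodian versions: STRUCTURE.md v1.0-SIGNED 9b196a05977dd067 (§1.1 C10 family-A plain member / C13 per-q law),
theory/FORMULA-N.md PART A §4.1″ (th-6: «the corrected enumerator is th-7's image model (PART B)»), PART B §A.3 / §E (th-7).
Model and dictionary (quoted, NOT asserted): file 1/3.  The Ext side (these ranks as `dim` of the `q`-pieces of `σ`'s image, the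
bridge `σ∘ev = ⌟ch`) stays on paper / by value, exactly as in `WedgeBoxPerQ*.lean`.

THIS FILE: §1 non-zero vectors with pairwise disjoint monomial supports are linearly independent; §2 **the range of the `q`-block of
`θ ↦ θ ∧ F_n` on `⋀^k` is the span of the `q`-components of the class vectors of degree `k` reaching `q`** — upper bound by the
local classification (every source image is `0` or a multiple of a class vector of the same degree, `lprod_eq_smul_vec`), lower
bound because each class vector is a unit multiple of an honest image `E_{src f} ∧ F_n` — hence **block rank = number of classes of
degree `k` reaching `q`** (`finrank_range_blockProj_wedge_surfaceBox_eq_card`, by §1 and the disjoint supports of file 2/3);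
§3 THE COUNT `|Fset n k q| = spCount n k q`: the trivariate generating function `Σ_f w^{z(f)} t^{k(f)} u^{q_f(f)} = (w + t(t+2+2u))ⁿ`
(`sum_prod_wt`, `Finset.prod_univ_sum`), `[w^z t^k u^{q_f}] = C(n,z) · classCount (n−z) k q_f` (`card_Nset`, binomial theorem +
`FormulaNSurfacePowerPerQ`'s coefficient lemmas), summed over the fibres `z(f) = z` and the shift `j`, `q_f = q − 2j` (`card_Fset`);
§4 **THE PER-`q` RANK THEOREM** `finrank_range_blockProj_wedge_surfaceBox` (every `n`, `k`, `q`; `a, c ≠ 0`; NO `k ≥ 1` hypothesis —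
the degree-0 exception of the two-factor law is built into `spCount`), the rows of record as RANK statements (F₃/F₄/F₅ `Ext²`-side
rows `(15,24,27,24,15)`, `(28,48,52,48,52,48,28)`, `(45,80,85,…)`, F₃ degree 1 `(6,…,6)`, the pre-registered F₆ / F₃,F₄-degree-3
rows, degree 0 at `n = 2`), and the generating-function form `rank = [t^k u^q] S_n(t,u)` (`…_eq_coeff_spGen`).
WHAT IS NOT HERE: any Ext-side statement (the (S2)-transport «rank of the q-blocks of σ itself», th-7 §G's `η`-weights, the
overlap identity and the closed-form rows in degrees 1–3 are in the companion `WedgeSurfacePowersPerQOverlap.lean`); sheaf-theoretic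
meaning of the classes.
Namespace `Summit.Ventures.HSemireg.Wedge.SurfacePowers`, new names only; nothing of th-7 / th-6 / p3 / p10 g0–g2 restated.
-/

open Module Set Set.powersetCard Polynomial

namespace Summit.Ventures.HSemireg.Wedge.SurfacePowers

open Summit.Ventures.HSemireg.Wedge Summit.Ventures.HSemireg.Wedge.Kunneth

variable (K : Type*) [Field K]

/-! ## §1. Vectors with disjoint monomial supports are independent -/

/-- non-zero vectors with pairwise disjoint monomial supports are linearly independent. -/
theorem linearIndependent_of_disjoint_support {I : Type*} [LinearOrder I] [Fintype I] {ι : Type*} [Fintype ι]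
    (v : ι → HT K I) (hv : ∀ x, v x ≠ 0)
    (hd : ∀ x x', x ≠ x' → ∀ T, (B K I).coord T (v x) = 0 ∨ (B K I).coord T (v x') = 0) :
    LinearIndependent K v := by
  classical
  rw [Fintype.linearIndependent_iff]
  intro g hg x₀
  obtain ⟨T, hT⟩ := (ne_zero_iff_exists_coord K (v x₀)).mp (hv x₀)
  have h := congr_arg ((B K I).coord T) hg
  rw [map_sum, map_zero, Finset.sum_eq_single x₀ _ (by simp)] at h
  · rw [map_smul, smul_eq_mul] at h
    exact (mul_eq_zero.mp h).resolve_right hT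
  · intro x _ hx
    rw [map_smul, smul_eq_mul]
    rcases hd x x₀ hx T with h0 | h0
    · rw [h0, mul_zero]
    · exact absurd h0 hT

variable {n : ℕ}

/-! ## §2. The range of the `q`-block of `θ ↦ θ ∧ F_n` on `⋀^k` is spanned by the class vectors it reaches -/

/-- the DEGREE of option data (total size of the canonical source). -/
def kf (f : Fin n → Fin 6) : ℕ := ∑ i, (opt (f i)).card

/-- the degree is the size of the canonical source. -/
lemma kf_eq_card_src (f : Fin n → Fin 6) : kf f = (src f).card := (card_src f).symm

variable (n)

/-- the option data of degree `k` whose class REACHES block `q` (`q = q_f + 2j`, `j ≤ z`). -/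
def Fset (k q : ℕ) : Finset (Fin n → Fin 6) :=
  Finset.univ.filter fun f => kf f = k ∧ ∃ j : Fin (zf f + 1), q = qff f + 2 * (j : ℕ)

variable {n}

/-- membership in `Fset`. -/
lemma mem_Fset {k q : ℕ} {f : Fin n → Fin 6} : f ∈ Fset n k q ↔ kf f = k ∧ ∃ j, j ≤ zf f ∧ q = qff f + 2 * j := by
  rw [Fset, Finset.mem_filter, and_iff_right (Finset.mem_univ f)]
  exact and_congr Iff.rfl ⟨fun ⟨j, h⟩ => ⟨j, Nat.lt_succ_iff.mp j.2, h⟩, fun ⟨j, hj, h⟩ => ⟨⟨j, Nat.lt_succ_iff.mpr hj⟩, h⟩⟩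

/-- **every source image is `0` or a multiple of a class vector of the same degree** (local classification on every block; a
dead block kills the image). -/
theorem lprod_eq_smul_vec {a c : K} (hc : c ≠ 0) (s : Finset (Fin (4 * n))) :
    lprod K a c s n = 0 ∨ ∃ f : Fin n → Fin 6, kf f = s.card ∧ ∃ Λ : K, lprod K a c s n = Λ • vec K a c f := by
  by_cases hdead : ∃ i, B K (Fin (2 + 2)) (pb n i s) * surf K a c = 0
  · left
    obtain ⟨i, hi⟩ := hdead
    apply lprod_eq_zero_of_limg K a c s i
    rw [limg_eq_emb, hi, map_zero]
  · right
    have hcl : ∀ i : Fin n, ∃ o : Fin 6, (opt o).card = (pb n i s).card ∧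
        ∃ μ : K, B K (Fin (2 + 2)) (pb n i s) * surf K a c = μ • (B K (Fin (2 + 2)) (opt o) * surf K a c) :=
      fun i => (local_class hc (pb n i s)).resolve_left (not_exists.mp hdead i)
    choose f hf1 hf2 using hcl
    choose μ hμ using hf2
    refine ⟨f, ?_, ?_⟩
    · rw [kf, card_eq_sum_card_pb s]
      exact Finset.sum_congr rfl fun i _ => hf1 i
    · have h : ∀ i, limg K a c s i = μ i • limg K a c (src f) i := by
        intro i
        rw [limg_eq_emb, limg_eq_emb, pb_src, hμ, map_smul]
      exact lprod_smul_of_limg K a c s (src f) μ h n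

/-- a monomial of the right size is in the exterior power. -/
lemma B_mem_exteriorPower {I : Type*} [LinearOrder I] [Fintype I] {s : Finset I} {k : ℕ} (hs : s.card = k) :
    B K I s ∈ ⋀[K]^k (I → K) := by
  rw [exteriorPower_eq_span]
  exact Submodule.subset_span ⟨s, hs, rfl⟩

/-- **the range of the `q`-block of `θ ↦ θ ∧ F_n` on `⋀^k K^{4n}` is the span of the `q`-components of the class vectors of
degree `k` reaching `q`** (`a, c ≠ 0`). -/
theorem range_blockProj_wedge_surfaceBox {a c : K} (ha : a ≠ 0) (hc : c ≠ 0) (k q : ℕ) :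
    LinearMap.range (blockProj K n q ∘ₗ wedge K (Fin (4 * n)) k (surfaceBox K (n := n) a c)) =
      Submodule.span K (Set.range fun f : Fset n k q => blockProj K n q (vec K a c f.1)) := by
  apply le_antisymm
  · rw [LinearMap.range_comp, range_wedge, Submodule.map_span, Submodule.span_le]
    rintro _ ⟨_, ⟨s, hs, rfl⟩, rfl⟩
    rw [SetLike.mem_coe]
    show blockProj K n q (B K (Fin (4 * n)) s * surfaceBox K (n := n) a c) ∈ _
    obtain ⟨μ, -, e⟩ := B_mul_surfaceBox K ha hc s
    rw [e, map_smul]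
    apply Submodule.smul_mem
    rcases lprod_eq_smul_vec K hc s with h0 | ⟨f, hf, Λ, hΛ⟩
    · rw [h0, map_zero]; exact Submodule.zero_mem _
    · rw [hΛ, map_smul]
      apply Submodule.smul_mem
      by_cases hr : ∃ j, j ≤ zf f ∧ q = qff f + 2 * j
      · exact Submodule.subset_span ⟨⟨f, mem_Fset.mpr ⟨hf.trans hs, hr⟩⟩, rfl⟩
      · rw [← blockProj_vec_ne_zero_iff K ha hc f q, not_ne_iff] at hr
        rw [hr]; exact Submodule.zero_mem _
  · rw [Submodule.span_le]
    rintro _ ⟨⟨f, hf⟩, rfl⟩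
    obtain ⟨hk, -⟩ := mem_Fset.mp hf
    obtain ⟨μ, hμ, e⟩ := B_mul_surfaceBox K ha hc (src f)
    have hv : vec K a c f = μ⁻¹ • (B K (Fin (4 * n)) (src f) * surfaceBox K (n := n) a c) := by
      rw [e, smul_smul, inv_mul_cancel₀ hμ, one_smul]; rfl
    rw [SetLike.mem_coe]
    show blockProj K n q (vec K a c f) ∈ _
    rw [hv, map_smul]
    apply Submodule.smul_mem
    exact ⟨⟨B K (Fin (4 * n)) (src f), B_mem_exteriorPower K (by rw [← kf_eq_card_src, hk])⟩, rfl⟩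

/-- **BLOCK RANK = NUMBER OF CLASSES REACHING THE BLOCK**: `rank(q-block of θ ↦ θ ∧ F_n ∣ ⋀^k) = |Fset n k q|`. -/
theorem finrank_range_blockProj_wedge_surfaceBox_eq_card {a c : K} (ha : a ≠ 0) (hc : c ≠ 0) (k q : ℕ) :
    finrank K (LinearMap.range (blockProj K n q ∘ₗ wedge K (Fin (4 * n)) k (surfaceBox K (n := n) a c))) =
      (Fset n k q).card := by
  rw [range_blockProj_wedge_surfaceBox K ha hc, finrank_span_eq_card, Fintype.card_coe]
  apply linearIndependent_of_disjoint_support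
  · rintro ⟨f, hf⟩
    exact (blockProj_vec_ne_zero_iff K ha hc f q).mpr (mem_Fset.mp hf).2
  · rintro ⟨f, hf⟩ ⟨f', hf'⟩ hne T
    simp only [coord_blockProj]
    split_ifs
    · exact coord_vec_eq_zero_or K ha hc (fun h => hne (Subtype.ext h)) T
    · exact Or.inl rfl


/-! ## §3. Counting the classes: `|Fset n k q| = spCount n k q` (trivariate generating function `(w + t(t + 2 + 2u))ⁿ`) -/

/-- the WEIGHT `w^z t^k u^{q_f}` of a local option, in `ℤ[u][t][w]` (outer variable `w = X`, middle `t = C X`, inner `u = C (C X)`):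
`∅ ↦ w`, an `X` letter `↦ tu`, a `Y` letter `↦ t`, the block `X ↦ t²`. -/
noncomputable def wt (o : Fin 6) : ℤ[X][X][X] :=
  C (C ((X : ℤ[X]) ^ lqf o) * (X : ℤ[X][X]) ^ (opt o).card) * (X : ℤ[X][X][X]) ^ lz o

/-- the weight of option data is the product of the local weights: `w^{z(f)} t^{k(f)} u^{q_f(f)}`. -/
lemma prod_wt (f : Fin n → Fin 6) :
    ∏ i, wt (f i) = C (C ((X : ℤ[X]) ^ qff f) * (X : ℤ[X][X]) ^ kf f) * (X : ℤ[X][X][X]) ^ zf f := by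
  simp only [wt, Finset.prod_mul_distrib, ← map_prod, Finset.prod_pow_eq_pow_sum]
  rfl

/-- the six local weights sum to `w + t(t + 2 + 2u)` (`= w + t² + 2t + 2tu`). -/
lemma sum_wt : ∑ o : Fin 6, wt o = X + C (X * (X + C (2 + 2 * X))) := by
  have h : (lqf 0, (opt 0).card, lz 0) = (0, 0, 1) ∧ (lqf 1, (opt 1).card, lz 1) = (1, 1, 0) ∧
      (lqf 2, (opt 2).card, lz 2) = (1, 1, 0) ∧ (lqf 3, (opt 3).card, lz 3) = (0, 1, 0) ∧
      (lqf 4, (opt 4).card, lz 4) = (0, 1, 0) ∧ (lqf 5, (opt 5).card, lz 5) = (0, 2, 0) := by decide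
  simp only [Prod.mk.injEq] at h
  obtain ⟨⟨a0, b0, c0⟩, ⟨a1, b1, c1⟩, ⟨a2, b2, c2⟩, ⟨a3, b3, c3⟩, ⟨a4, b4, c4⟩, ⟨a5, b5, c5⟩⟩ := h
  simp only [Fin.sum_univ_six, wt, a0, b0, c0, a1, b1, c1, a2, b2, c2, a3, b3, c3, a4, b4, c4, a5, b5, c5, pow_zero, pow_one,
    one_mul, mul_one, map_mul, map_pow, map_add, map_ofNat]
  ring

/-- **the generating function**: `Σ_f w^{z(f)} t^{k(f)} u^{q_f(f)} = (w + t(t + 2 + 2u))ⁿ`. -/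
theorem sum_prod_wt : ∑ f : Fin n → Fin 6, ∏ i, wt (f i) = (X + C (X * (X + C (2 + 2 * X)))) ^ n := by
  rw [← sum_wt, ← Fintype.piFinset_univ,
    ← Finset.prod_univ_sum (fun _ : Fin n => (Finset.univ : Finset (Fin 6))) (fun _ o => wt o),
    Finset.prod_const, Finset.card_univ, Fintype.card_fin]

/-- the coefficient of one weight is the indicator of its exponents. -/
lemma coeff_prod_wt (f : Fin n → Fin 6) (z k qf : ℕ) :
    (((∏ i, wt (f i)).coeff z).coeff k).coeff qf = if zf f = z ∧ kf f = k ∧ qff f = qf then 1 else 0 := by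
  rw [prod_wt, coeff_C_mul_X_pow]
  by_cases hz : zf f = z
  · rw [if_pos hz.symm, coeff_C_mul_X_pow]
    by_cases hk : kf f = k
    · rw [if_pos hk.symm, coeff_X_pow]
      by_cases hq : qff f = qf
      · rw [if_pos hq.symm, if_pos ⟨hz, hk, hq⟩]
      · rw [if_neg (Ne.symm hq), if_neg (fun h => hq h.2.2)]
    · rw [if_neg (Ne.symm hk), Polynomial.coeff_zero, if_neg (fun h => hk h.2.1)]
  · rw [if_neg (Ne.symm hz), Polynomial.coeff_zero, Polynomial.coeff_zero, if_neg (fun h => hz h.1)]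

variable (n)

/-- the option data with `z` empty blocks, degree `k` and fixed part `q_f`. -/
def Nset (z k qf : ℕ) : Finset (Fin n → Fin 6) := Finset.univ.filter fun f => zf f = z ∧ kf f = k ∧ qff f = qf

variable {n}

/-- their number is a coefficient of the generating function. -/
lemma card_Nset_eq_coeff (z k qf : ℕ) :
    ((Nset n z k qf).card : ℤ) = ((((X + C (X * (X + C (2 + 2 * X))) : ℤ[X][X][X]) ^ n).coeff z).coeff k).coeff qf := by
  rw [← sum_prod_wt, finsetSum_coeff, finsetSum_coeff, finsetSum_coeff]
  simp_rw [coeff_prod_wt]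
  rw [Finset.sum_boole, Nset]

/-- **`|Nset n z k q_f| = C(n,z) · classCount (n−z) k q_f`** (`z ≤ n`; choose the empty blocks, then `classCount` of
`FormulaNSurfacePowerPerQ.lean` on the `n − z` non-empty ones: binomial theorem in `w`, then `[t^k u^{q_f}](t(t+2+2u))^m`). -/
theorem card_Nset (z k qf : ℕ) : (Nset n z k qf).card = n.choose z * FormulaN.Uniform.classCount (n - z) k qf := by
  have h := card_Nset_eq_coeff (n := n) z k qf
  have e : (X * (X + C (2 + 2 * X)) : ℤ[X][X]) ^ (n - z) * (n.choose z : ℤ[X][X]) =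
      C 1 * (X * (X + C (2 + 2 * X))) ^ (n - z) * (n.choose z : ℤ[X][X]) := by
    rw [C_1, one_mul]
  rw [coeff_X_add_C_pow, e, FormulaN.Uniform.coeff_C_mul_X_mul_pow_mul_natCast] at h
  rw [FormulaN.Uniform.classCount]
  split_ifs at h with hm
  · rw [one_mul, coeff_mul_natCast, coeff_mul_natCast, FormulaN.Uniform.coeff_two_add_two_X_pow] at h
    by_cases hk2 : k ≤ (n - z) + (n - z)
    · rw [if_pos ⟨hm, hk2⟩]
      have e1 : n - z - (k - (n - z)) = (n - z) + (n - z) - k := by omega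
      rw [e1] at h
      zify
      rw [h]
      ring
    · rw [if_neg (fun h' => hk2 h'.2), mul_zero]
      have e2 : (n - z).choose (k - (n - z)) = 0 := Nat.choose_eq_zero_of_lt (by omega)
      rw [e2] at h
      push_cast at h
      simpa using h
  · rw [if_neg (fun h' => hm h'.1), mul_zero]
    rw [Polynomial.coeff_zero] at h
    exact_mod_cast h

/-- the reach indicator as a sum over the candidate shifts `j` (at most one `j` fits). -/
lemma ite_reach_eq_sum (f : Fin n → Fin 6) (k q : ℕ) :
    (if kf f = k ∧ ∃ j : Fin (zf f + 1), q = qff f + 2 * (j : ℕ) then 1 else 0) =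
      ∑ j ∈ Finset.range (zf f + 1), (if kf f = k ∧ q = qff f + 2 * j then 1 else 0) := by
  by_cases hk : kf f = k
  · simp only [hk, true_and]
    rw [Finset.sum_boole, Nat.cast_id]
    have hle : ((Finset.range (zf f + 1)).filter fun j => q = qff f + 2 * j).card ≤ 1 :=
      Finset.card_le_one.mpr fun a ha b hb => by
        rw [Finset.mem_filter] at ha hb
        omega
    split_ifs with hj
    · obtain ⟨j, hj⟩ := hj
      refine le_antisymm ?_ hle
      rw [Nat.one_le_iff_ne_zero, Ne, Finset.card_eq_zero, ← Ne, ← Finset.nonempty_iff_ne_empty]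
      exact ⟨j, Finset.mem_filter.mpr ⟨Finset.mem_range.mpr j.2, hj⟩⟩
    · rw [eq_comm, Finset.card_eq_zero, Finset.filter_eq_empty_iff]
      intro j hjr h
      exact hj ⟨⟨j, Finset.mem_range.mp hjr⟩, h⟩
  · simp [hk]

/-- the number of empty blocks is at most `n`. -/
lemma zf_le (f : Fin n → Fin 6) : zf f ≤ n := by
  rw [zf_eq_card]
  exact (Finset.card_le_univ _).trans (by rw [Fintype.card_fin])

/-- in the fibre `z(f) = z`: the classes of degree `k` reaching `q` with shift `j` number `[2j ≤ q] · |Nset z k (q − 2j)|`. -/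
lemma sum_fiber_eq (z k q j : ℕ) :
    ∑ f ∈ Finset.univ.filter (fun f : Fin n → Fin 6 => zf f = z), (if kf f = k ∧ q = qff f + 2 * j then 1 else 0) =
      if 2 * j ≤ q then (Nset n z k (q - 2 * j)).card else 0 := by
  split_ifs with hj
  · rw [Finset.sum_boole, Nat.cast_id, Finset.filter_filter, Nset]
    congr 1
    ext f
    simp only [Finset.mem_filter, Finset.mem_univ, true_and]
    omega
  · exact Finset.sum_eq_zero fun f _ => if_neg fun h => hj (by omega)

/-- **THE COUNT: `|Fset n k q| = spCount n k q`** — the classes of degree `k` reaching block `q` are counted by p10's corrected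
enumerator of `FormulaNSurfacePowerPerQ.lean` (sum over the number `z` of empty blocks and the shift `j ≤ z`, `q_f = q − 2j`). -/
theorem card_Fset (k q : ℕ) : (Fset n k q).card = FormulaN.Uniform.spCount n k q := by
  rw [Fset, Finset.card_filter]
  simp_rw [ite_reach_eq_sum]
  rw [← Finset.sum_fiberwise_of_maps_to (s := Finset.univ) (t := Finset.range (n + 1)) (g := zf)
    (fun f _ => Finset.mem_range.mpr (Nat.lt_succ_of_le (zf_le f))), FormulaN.Uniform.spCount]
  refine Finset.sum_congr rfl fun z _ => ?_
  rw [Finset.sum_congr rfl (fun f hf => by rw [(Finset.mem_filter.mp hf).2]), Finset.sum_comm, Finset.mul_sum]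
  refine Finset.sum_congr rfl fun j _ => ?_
  rw [sum_fiber_eq, card_Nset, mul_ite, mul_zero]


/-! ## §4. THE PER-`q` RANK THEOREM FOR SURFACE POWERS, every `n`, `k`, `q` -/

/-- **THE PER-`q` RANK THEOREM FOR THE `n`-FOLD SURFACE BOX.**  For every field `K`, every `n`, every degree `k`, every block
`q` and `a, c ≠ 0`: the rank of the `q`-block of `θ ↦ θ ∧ F_n` on `⋀^k K^{4n}` (`F_n = f₀ ∧ ⋯ ∧ f_{n−1}`, `f_i = a·E_{X_i} + c·E_{Y_i}`,
th-7's model of `⌟ch(I_{p₁} ⊠ ⋯ ⊠ I_{pₙ})` on `HT^k((E²)ⁿ)`; `q` = number of `X`-generators missing from the target monomial, the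
model of the Dolbeault index of `H^{q+m}(Ω^q)`) is p10's corrected enumerator `spCount n k q = Σ_z C(n,z) Σ_{j ≤ z, 2j ≤ q}
classCount (n−z) k (q−2j)` of `FormulaNSurfacePowerPerQ.lean` — the class decomposition of SURFACE-POWER-PERQ-p10.md §2 as a
kernel theorem (there: «NOT typed»).  No hypothesis `k ≥ 1`: in degree `0` the single source `θ = 1` is ONE class with `n` empty
blocks, reaching `q = 0, 2, …, 2n` once each (the `m ≥ 1` exception of the two-factor per-q law is built into `spCount`). -/
theorem finrank_range_blockProj_wedge_surfaceBox {a c : K} (ha : a ≠ 0) (hc : c ≠ 0) (k q : ℕ) :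
    finrank K (LinearMap.range (blockProj K n q ∘ₗ wedge K (Fin (4 * n)) k (surfaceBox K (n := n) a c))) =
      FormulaN.Uniform.spCount n k q := by
  rw [finrank_range_blockProj_wedge_surfaceBox_eq_card K ha hc, card_Fset]

/-- **the measured rows of record are now kernel RANK statements** (degree 2): F₃ `(15,24,27,24,15)` (engine-1 DIRECT j161105 ✓th-7),
F₄ `(28,48,52,48,52,48,28)`, F₅ `(45,80,85,80,85,80,85,80,45)` (FORMULA-N §4.1) — th-6's naive `[t²u^q]Q_2³ = (15,24,30,24,15)`
is NOT the rank. -/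
theorem perq_rows_two {a c : K} (ha : a ≠ 0) (hc : c ≠ 0) :
    (List.range 5).map (fun q => finrank K (LinearMap.range (blockProj K 3 q ∘ₗ wedge K (Fin (4 * 3)) 2 (surfaceBox K (n := 3) a c))))
      = [15, 24, 27, 24, 15] ∧
    (List.range 7).map (fun q => finrank K (LinearMap.range (blockProj K 4 q ∘ₗ wedge K (Fin (4 * 4)) 2 (surfaceBox K (n := 4) a c))))
      = [28, 48, 52, 48, 52, 48, 28] ∧
    (List.range 9).map (fun q => finrank K (LinearMap.range (blockProj K 5 q ∘ₗ wedge K (Fin (4 * 5)) 2 (surfaceBox K (n := 5) a c))))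
      = [45, 80, 85, 80, 85, 80, 85, 80, 45] := by
  simp only [finrank_range_blockProj_wedge_surfaceBox K ha hc]
  exact FormulaN.Uniform.spCount_rows_two

/-- degree 1 at `n = 3`: the rank row is `(6,6,6,6,6,6)` (engine-1 DIRECT j161490), not the naive `(6,6,12,12,6,6)`; and the
pre-registered / engine-confirmed rows F₆ `Ext²` `(66,120,126,120,126,120,126,120,126,120,66)`, F₃ `Ext³` `(20,36,36,20)`,
F₄ `Ext³` `(56,120,152,152,120,56)` (confirmed class-side by engine-w-1 code A, bus 2026-08-23T09:36:30Z, and object-side by t-26's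
t26sig 0.9.2, bus 11:36:13Z) as rank statements. -/
theorem perq_rows_one_three_six {a c : K} (ha : a ≠ 0) (hc : c ≠ 0) :
    (List.range 6).map (fun q => finrank K (LinearMap.range (blockProj K 3 q ∘ₗ wedge K (Fin (4 * 3)) 1 (surfaceBox K (n := 3) a c))))
      = [6, 6, 6, 6, 6, 6] ∧
    (List.range 11).map (fun q => finrank K (LinearMap.range (blockProj K 6 q ∘ₗ wedge K (Fin (4 * 6)) 2 (surfaceBox K (n := 6) a c))))
      = [66, 120, 126, 120, 126, 120, 126, 120, 126, 120, 66] ∧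
    (List.range 6).map (fun q => finrank K (LinearMap.range (blockProj K 3 q ∘ₗ wedge K (Fin (4 * 3)) 3 (surfaceBox K (n := 3) a c))))
      = [20, 36, 36, 20, 0, 0] ∧
    (List.range 6).map (fun q => finrank K (LinearMap.range (blockProj K 4 q ∘ₗ wedge K (Fin (4 * 4)) 3 (surfaceBox K (n := 4) a c))))
      = [56, 120, 152, 152, 120, 56] := by
  simp only [finrank_range_blockProj_wedge_surfaceBox K ha hc]
  exact ⟨FormulaN.Uniform.spCount_rows_one.1, FormulaN.Uniform.spCount_predictions⟩

/-- degree 0 (no `k ≥ 1` needed here): at `n = 2` the block ranks of `θ = 1 ↦ F_2` are `(1,0,1,0,1)` — ONE source vector with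
components in blocks `0, 2, 4` — where the two-factor per-q count `blockCount 2 0 = (1,0,2,0,1)` overcounts
(`WedgeBoxPerQOverlap.perq_law_fails_in_degree_zero`). -/
theorem perq_row_zero_two {a c : K} (ha : a ≠ 0) (hc : c ≠ 0) :
    (List.range 5).map (fun q => finrank K (LinearMap.range (blockProj K 2 q ∘ₗ wedge K (Fin (4 * 2)) 0 (surfaceBox K (n := 2) a c))))
      = [1, 0, 1, 0, 1] := by
  simp only [finrank_range_blockProj_wedge_surfaceBox K ha hc]
  exact FormulaN.Uniform.spCount_two_eq_blockCount.2.1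

/-- **the generating-function form**: the rank of the `q`-block in degree `k` is `[t^k u^q] S_n(t,u)`,
`S_n = Σ_z C(n,z)(1 + u² + ⋯ + u^{2z})(t(t+2+2u))^{n−z}` (`FormulaN.Uniform.coeff_spGen`) — th-6's `Q_2(t,u)ⁿ` with `(1+u²)^z`
replaced by `1 + u² + ⋯ + u^{2z}`. -/
theorem finrank_range_blockProj_wedge_surfaceBox_eq_coeff_spGen {a c : K} (ha : a ≠ 0) (hc : c ≠ 0) (k q : ℕ) :
    (finrank K (LinearMap.range (blockProj K n q ∘ₗ wedge K (Fin (4 * n)) k (surfaceBox K (n := n) a c))) : ℤ) =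
      ((FormulaN.Uniform.spGen n).coeff k).coeff q := by
  rw [finrank_range_blockProj_wedge_surfaceBox K ha hc, FormulaN.Uniform.coeff_spGen]

end Summit.Ventures.HSemireg.Wedge.SurfacePowers
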